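/-
Copyright: the b2b-balaban cell (near-miss cell 7), T⁴-continuum fan-out; row NE7b ROUND-2 swarm, seat
t4-ne7b-formalise-leaf-04 (gen 2) — row S6e in the LE currency (journal CLAIM l.7590; junction item INFO-1 of the
cross-read l.7478).  Released under the licence of the surrounding project.
-/
import Summits.QuantumFields.BalabanUV.T4Continuum.Support.HistoryZoneSurchargeTagged
import Summits.QuantumFields.BalabanUV.T4Continuum.Support.HistorySocketTHLE

/-!
# Row NE7b, leaf S6e in the LE currency: the class-linear and the tagged-zone exits WITHOUT the renewal-at-reach clause

Summits-side support leaf of the T⁴-continuum cell (rung (B)+1 on a FINITE torus only; NOT infinite volume, NOT the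
mass gap, NOT the Clay statement; NOT a proof of the spine estimate NE7b).  Row NE7b, route «COUNT», ROUND-2 swarm
claim table `t4/b2b-balaban-t4-ne7b-p1/LEAVES-NE7b.md`, row S6e (zone surcharge vs the exit) re-derived in row S4c's
LE currency, seat `t4-ne7b-formalise-leaf-04` gen 2.  [folklore] bookkeeping over the lineage's OWN typed carrier;
nothing is quoted from print, nothing printed is asserted, no `[cite:]` tag, no `Prop`-valued fact is minted (trigger
c1); the two named thresholds are real numbers depending on the symbolic constants only — shape-free AND horizon-free
(c2∕c6, R-OWNER-22-11).

WHY.  Leaf-05's zone-surcharge exits (`HistoryZoneSurcharge.relWeightBound_lateMergersG∕Z_of_irThreshold`, p208647;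
`HistoryZoneSurchargeTagged.…ZS∕ZS0…`, p209520) absorb the (GM) zone multiplicity of a tagged genealogy into the birth
credits against the TH exit, whose labelling binder asks `ConsistentTH … D` ∕ `ConsistentT` — renewal AT the booked
reach, i.e. the display `RenewAtReach` (F-1(c): not a fact of the geometry).  Row S4c (leaf-02) re-derived the exit
over `HistoryBankingLE.ConsistentTLE` (`HistoryExitLE.relWeightBound_canon_of_irThresholdLE`, p208972) and the
consumers are switching (`HistoryAssemblyTreesLE` p210307, `HistorySocketTHLE` p210582).  An END that is both LE (no
`RenewAtReach`) and zone-absorbed (the typer's A12-I.Z; the terminal G exit of row S6g′) needs the G∕ZS exits over the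
LE exit.  This file re-derives them; the proofs are leaf-05's, with leaf-02's exit in place of the TH exit.

WHAT.  §1 LE helpers: `consistentTLE_lowerA_iff` (`ConsistentTLE` reads only `n₁`), `kind_eq_zero_of_mem_birthsTLE`,
`births_subset_filterTLE`, `stepsOK_of_consistentTLE`, `ordered_of_consistentTLE` (structural recursions),
`exp_mul_fatSumT_mul_exp_neg_credits_le_floor_of_births` (leaf-05's floor lemma with the hypothesis «births are kind-0
events» in place of `ConsistentTH`).  §2 **`irThresholdGTLE C θ L r β₀`** := `max (irThresholdTLE (lowerA C (a∕2)) L r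
β₀) (max 1 (2θ(1+β₀)²∕(a·A₀²)))` and **`relWeightBound_lateMergersG_of_irThresholdLE`** = leaf-02's
`relWeightBound_canon_of_irThresholdLE` VERBATIM except: a free rate `θ ≥ 0`, the infrared smallness at
`irThresholdGTLE`, and the binder **`hlabGTLE`** — the slot price is `≤ 0` or at most
`Δ·exp(θ·Σ_{b ∈ births G′}((sh b).fat+1))·Λ′^{partnerAges}·e^{−credits}·e^{+lifeCost}` of a `ConsistentTLE`, WELL
FORMED tagged genealogy pending at `K` with the slot's shape tree (proof: the LE exit at `lowerA C (a∕2)`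
(`thresholdOK_half`), the surcharge paid by lowering `a` by `θ∕P²` against the run's infrared floor — `floor_of_ir`,
`half_room_of_threshold`, `creditsT_lowerA_anti`, `costT_lowerA`).  §3 **`irThresholdZTLE C Kz p σ ε θ L r β₀`** :=
`irThresholdGTLE C (zoneRate Kz p σ ε θ) L r β₀` and **`relWeightBound_lateMergersZS_of_irThresholdLE`**: the same with
zone constants, placement rate `Λ′e^{ε}` in the two rate conditions, and the binder **`hlabZSLE`** — price factor
`Kz^{#merges G′}·∏_{e ∈ merges G′} Q(wcntS sh G′, σ, (sh e).step)^p·Λ′^{partnerAges (step∘sh) G′}` for a `ConsistentTLE`,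
well formed, BIRTH-SHAPE-GENERIC (`Set.InjOn sh ↑(births G′)` = `BirthShapeNodup`, displayed) tagged genealogy
(proof: leaf-05's `HistoryCrowdingTagged.zone_surchargeS_le` fed the binder's `Gen.WF`, §1, then §2).  Conclusions =
the LE exit's VERBATIM (`∃ K₁ ≥ K₀, RelWeightBound … (𝟙·Cn·recordsBudget (Δ·birthMass C) C.κ₁ V Λ η̄₊ j⋆)`).  §4 sanity.

HONEST.  Re-derivation of OUR exits with one clause of OUR predicate relaxed; residual classes unchanged (equal-shape
sibling crowds where `BirthShapeNodup` fails — row S6g′; window drops — row S6f); nothing of H3 ∕ (B) ∕ BetaPertH;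
NE7b NOT proved; spine 0∕9.  HONEST DEPENDENCY (cell): continuum YM on T⁴ ⇐ BetaPertH ∧ nine spine estimates (0/9
proved); BetaPertH ⇐ (D1) ∧ (D4) ∧ CAP+tail; G-an2-4 gates asym, D1 and NE2/3/4.  This file changes none of it.
-/

open Finset
open Literature.MathematicalPhysics.QuantumFieldTheory.Balaban1983to89
open T4PersistenceDictionary T4PersistentHistoryCount T4BankedInduction T4PrintedShapeBanking T4PartnerMultiplicity
open T4WeightBudget T4GlobalDenominator T4LiveClassFibration T4LiveStructureGas T4LiveGasToTerms T4RecordPriceSeam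
open T4BranchingRecordsGas T4TaggedShapeBanking T4CanonicalMenus T4CountHorizon T4MatchingClosureSocket
open Summit.QuantumFields.BalabanUV.T4Continuum
open PlacementBatch PlacementSkeleton PartnerMultiplicityF PartnerMultiplicityG PartnerMultiplicityZ
open PartnerMultiplicityFloor PartnerMultiplicityThreshold Crowding CountThresholdUniform CountThresholdExit
open LateMergers ZoneSkeleton HistoryConsistent HistoryZones HistoryZoneSurcharge HistoryCrowdingTagged
open HistoryBankingLE HistoryTreeShapeLE HistoryCanonLE HistoryExitLE HistorySocketTHLE

namespace Summit.QuantumFields.BalabanUV.T4Continuum.HistoryZoneSurchargeLE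

noncomputable section

/-! ## §1 LE helpers: what does not see `a`; births; steps; the floor lemma from kind-0 births -/

section Helpers

variable {ε : Type*} [DecidableEq ε] (sh : ε → PEv)

omit [DecidableEq ε] in
/-- `ConsistentTLE` reads only `n₁` of the constants: LE consistency at `lowerA C θ` is the one at `C`. [folklore] -/
theorem consistentTLE_lowerA_iff (C : T4PrintedShapeBanking.Consts) (θ : ℝ) (K : ℕ) (R : ℕ → ℕ) :
    ∀ G : Gen ε, ConsistentTLE sh (lowerA C θ) K R G ↔ ConsistentTLE sh C K R G
  | Gen.born _ _ => Iff.rfl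
  | Gen.renew G e h => by
      simp only [ConsistentTLE, consistentTLE_lowerA_iff C θ K R G, lowerA_n₁]
  | Gen.merge X Y e => by
      simp only [ConsistentTLE, consistentTLE_lowerA_iff C θ K R X, consistentTLE_lowerA_iff C θ K R Y, lowerA_n₁]

variable {sh}

omit [DecidableEq ε] in
/-- the birth labels of a `ConsistentTLE` tagged genealogy are dated by their shapes [folklore] -/
theorem stepsOK_of_consistentTLE {C : T4PrintedShapeBanking.Consts} {K : ℕ} {R : ℕ → ℕ} :
    ∀ {G : Gen ε}, ConsistentTLE sh C K R G → StepsOK (PEv.step ∘ sh) G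
  | Gen.born _ _, hc => hc.2.1
  | Gen.renew G _ _, hc => show StepsOK (PEv.step ∘ sh) G from stepsOK_of_consistentTLE hc.1
  | Gen.merge _ _ _, hc => ⟨stepsOK_of_consistentTLE hc.1, stepsOK_of_consistentTLE hc.2.1⟩

omit [DecidableEq ε] in
/-- the mergers of a `ConsistentTLE` tagged genealogy are ordered (`rootStep ≤ step ≤ step + 1`) [folklore] -/
theorem ordered_of_consistentTLE {C : T4PrintedShapeBanking.Consts} {K : ℕ} {R : ℕ → ℕ} :
    ∀ {G : Gen ε}, ConsistentTLE sh C K R G → Ordered (PEv.step ∘ sh) G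
  | Gen.born _ _, _ => trivial
  | Gen.renew G _ _, hc => show Ordered (PEv.step ∘ sh) G from ordered_of_consistentTLE hc.1
  | Gen.merge _ _ _, hc => ⟨ordered_of_consistentTLE hc.1, ordered_of_consistentTLE hc.2.1,
      Nat.le_succ_of_le hc.2.2.2.1, Nat.le_succ_of_le hc.2.2.2.2.2.1⟩

/-- the births of a `ConsistentTLE` tagged genealogy have shape kind `0` [folklore] -/
theorem kind_eq_zero_of_mem_birthsTLE {C : T4PrintedShapeBanking.Consts} {K : ℕ} {R : ℕ → ℕ} :
    ∀ {G : Gen ε}, ConsistentTLE sh C K R G → ∀ b ∈ births G, (sh b).kind = 0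
  | Gen.born b j, hc, b', hb' => by
      simp only [births_born, mem_singleton] at hb'
      exact hb' ▸ hc.1
  | Gen.renew G e h, hc, b', hb' => kind_eq_zero_of_mem_birthsTLE (G := G) hc.1 b' hb'
  | Gen.merge X Y e, hc, b', hb' => by
      rcases mem_union.1 hb' with h | h
      · exact kind_eq_zero_of_mem_birthsTLE hc.1 b' h
      · exact kind_eq_zero_of_mem_birthsTLE hc.2.1 b' h

/-- **THE BIRTHS OF A `ConsistentTLE` TAGGED GENEALOGY ARE KIND-`0` EVENTS.** [folklore] -/
theorem births_subset_filterTLE {C : T4PrintedShapeBanking.Consts} {K : ℕ} {R : ℕ → ℕ} {G : Gen ε}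
    (hc : ConsistentTLE sh C K R G) : births G ⊆ G.events.filter fun e => (sh e).kind = 0 := fun b hb =>
  mem_filter.2 ⟨births_subset_events G hb, kind_eq_zero_of_mem_birthsTLE hc b hb⟩

/-- **THE CLASS-LINEAR SURCHARGE ON THE TAGGED BIRTHS IS PAID BY THE TAGGED CREDITS, WITH A FLOOR** — leaf-05's
`exp_mul_fatSumT_mul_exp_neg_credits_le_floor` with the one use of consistency (births are kind-`0` events) made the
hypothesis, so that it serves `ConsistentTLE` (and any other admissibility predicate) alike. [folklore] -/
theorem exp_mul_fatSumT_mul_exp_neg_credits_le_floor_of_births {C : T4PrintedShapeBanking.Consts} {g : ℕ → ℝ}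
    {θ P : ℝ} (hθ : 0 ≤ θ) (hP : 0 < P) {G : Gen ε} (hb : births G ⊆ G.events.filter fun e => (sh e).kind = 0)
    (hPe : ∀ e ∈ G.events, (sh e).kind = 0 → P ≤ p0Profile C.A₀ C.p₀ (g (sh e).step)) :
    Real.exp (θ * ∑ b ∈ births G, ((((sh b).fat : ℕ) : ℝ) + 1)) * Real.exp (-credits (credit C g ∘ sh) G) ≤
      Real.exp (-credits (credit (lowerA C (θ / P ^ 2)) g ∘ sh) G) := by
  have h1 := creditsT_lowerA_add_le_floor (sh := sh) hθ hP G hPe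
  have h2 : ∑ b ∈ births G, ((((sh b).fat : ℕ) : ℝ) + 1) ≤
      ∑ e ∈ G.events.filter (fun e => (sh e).kind = 0), ((((sh e).fat : ℕ) : ℝ) + 1) :=
    sum_le_sum_of_subset_of_nonneg hb fun _ _ _ => by positivity
  rw [← Real.exp_add, Real.exp_le_exp]
  nlinarith [mul_le_mul_of_nonneg_left h2 hθ]

end Helpers

/-! ## §2 The LE exit with the class-linear binder (`hlabGTLE`), threshold named (shape-free, horizon-free) -/

/-- **THE CLASS-LINEAR LE THRESHOLD, NAMED**: leaf-02's `irThresholdTLE` at HALF the quadratic constant, enlarged to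
`≥ 1` and `≥ 2θ(1+β₀)²∕(a·A₀²)`.  A function of `(C, θ, L, r, β₀)` only — no shape map, no horizon. [folklore] -/
def irThresholdGTLE (C : T4PrintedShapeBanking.Consts) (θ : ℝ) (L r : ℕ) (β₀ : ℝ) : ℝ :=
  max (irThresholdTLE (lowerA C (C.a / 2)) L r β₀) (max 1 (2 * θ * (1 + β₀) ^ 2 / (C.a * C.A₀ ^ 2)))

/-- **THE ZONE LE THRESHOLD, NAMED**: the class-linear one at `θ := zoneRate Kz p σ ε θ`. [folklore] -/
def irThresholdZTLE (C : T4PrintedShapeBanking.Consts) (Kz p σ ε θ : ℝ) (L r : ℕ) (β₀ : ℝ) : ℝ :=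
  irThresholdGTLE C (zoneRate Kz p σ ε θ) L r β₀

/-- the class-linear LE threshold dominates the half-constant LE threshold [folklore] -/
theorem irThresholdTLE_le_irThresholdGTLE (C : T4PrintedShapeBanking.Consts) (θ : ℝ) (L r : ℕ) (β₀ : ℝ) :
    irThresholdTLE (lowerA C (C.a / 2)) L r β₀ ≤ irThresholdGTLE C θ L r β₀ := le_max_left _ _

/-- it is at least `1` [folklore] -/
theorem one_le_irThresholdGTLE (C : T4PrintedShapeBanking.Consts) (θ : ℝ) (L r : ℕ) (β₀ : ℝ) :
    1 ≤ irThresholdGTLE C θ L r β₀ := (le_max_left _ _).trans (le_max_right _ _)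

/-- it dominates the half-room ratio [folklore] -/
theorem room_le_irThresholdGTLE (C : T4PrintedShapeBanking.Consts) (θ : ℝ) (L r : ℕ) (β₀ : ℝ) :
    2 * θ * (1 + β₀) ^ 2 / (C.a * C.A₀ ^ 2) ≤ irThresholdGTLE C θ L r β₀ := (le_max_right _ _).trans (le_max_right _ _)

section EndToEnd

variable {ε : Type*} [DecidableEq ε]
variable {γ κ ι : Type*} [DecidableEq γ] [DecidableEq κ] {l₀ : ℝ} {K₀ : ℕ} {π : ℕ → ι → κ} {T : ℕ → Finset ι}
  {A A' : ℕ → ℝ → ι → ℝ} {Bad' : ℕ → ℝ → Finset κ} {dead dead' : ℕ → ℝ → ι → ℝ} {F Rf F' Rf' : ℕ → κ → ℝ}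
  {nlow nup mlow mup : ℕ → ℝ → ℝ} {Cn : ℝ}

/-- **THE LE EXIT WITH THE CLASS-LINEAR BINDER `hlabGTLE`, NO ROOM CONDITION, THRESHOLD NAMED.**  Leaf-02's
`HistoryExitLE.relWeightBound_canon_of_irThresholdLE` VERBATIM except: a free rate `θ ≥ 0`; the infrared smallness at
`irThresholdGTLE C θ L r β₀`; the slot price may carry the extra factor `exp(θ·Σ_{b ∈ births G′}((sh b).fat+1))`.
Proof: the LE exit at `lowerA C (a∕2)` (`thresholdOK_half`; `ConsistentTLE`, `Gen.WF`, the reach and the booked cost do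
not read `a`), the surcharge paid by lowering `a` by `θ∕P²` against the infrared floor `P = A₀·x^{p₀}∕(1+β₀)` of the
run (`floor_of_ir`, `half_room_of_threshold`, `θ∕P² ≤ a∕2`, `creditsT_lowerA_anti`). [folklore] -/
theorem relWeightBound_lateMergersG_of_irThresholdLE (sh : ε → PEv) {C : T4PrintedShapeBanking.Consts} {L r : ℕ}
    {β₀ : ℝ} (h : ThresholdOK C L r β₀) (hμ₀ : 0 < C.μ) {θ : ℝ} (hθ : 0 ≤ θ)
    (Cell : ℕ → ℕ → Finset γ) {V Λ : ℝ} (hV : 0 ≤ V) (hΛ : 0 < Λ)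
    (hcell : ∀ K a, ((Cell K a).card : ℝ) ≤ V * Λ ^ a) (Dcap Ncap : ℕ → ℕ)
    (jstar : ℕ → ℕ) (hj : ∀ K, jstar K ≤ K) {c : ℝ} (hc : 0 < c)
    (hfrac : ∀ K : ℕ, c * K ≤ ((K - jstar K : ℕ) : ℝ)) {Δ : ℝ} (hΔ : 1 ≤ Δ)
    (hA : Regeneration l₀ π T A Bad' dead F Rf nlow nup Cn K₀)
    (hA' : Regeneration l₀ π T A' Bad' dead' F' Rf' mlow mup Cn K₀) (hCn : 0 ≤ Cn)
    (R : ℕ → ℕ → ℕ) (g : ℕ → ℕ → ℝ) (β' : ℕ → ℝ)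
    (h27 : ∀ K, K₀ ≤ K → B14.FlowIneq27 (g K) (β' K) β₀ C.p₀ K)
    (h29 : ∀ K, K₀ ≤ K → B14FlowStep.FlowIneq29 (R K) (g K) L (β' K) β₀ K)
    (hR : ∀ K, K₀ ≤ K → ∀ s, s ≤ K → B14.IsRj L r (g K s) (R K s))
    (hx1 : ∀ K, K₀ ≤ K → ∀ s, s ≤ K → 1 ≤ Real.log ((g K s) ^ 2)⁻¹)
    (hir : ∀ K, K₀ ≤ K → irThresholdGTLE C θ L r β₀ ≤ Real.log ((g K K) ^ 2)⁻¹)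
    (hP : ∀ K s, 0 ≤ p0Profile C.A₀ C.p₀ (g K s))
    {ηplus : ℝ} (hηplus : 0 ≤ ηplus) (hr : Λ * Real.exp (ηplus - C.κ₁) < 1)
    {Λ' : ℝ} (hΛ0 : 0 ≤ Λ') (h1 : Λ' * Real.exp (-C.κ₁) * Real.exp ηplus < 1)
    (hx : (Real.exp (-C.E₀) + Real.exp (-C.E₀) * birthMass C *
          (Λ' * Real.exp (-C.κ₁) / (1 - Λ' * Real.exp (-C.κ₁) * Real.exp ηplus))) * Real.exp ηplus ≤
        Real.exp ηplus - 1)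
    (y : ℕ → ℕ → γ → Gen PEv → ℝ)
    (hy0 : ∀ K, ∀ j ≤ K, ∀ z ∈ Cell K (K - j), ∀ G ∈ canonFam Dcap Ncap K j, 0 ≤ y K j z G)
    (hlabGTLE : ∀ K, K₀ ≤ K → ∀ j ≤ K, ∀ z ∈ Cell K (K - j), ∀ G ∈ canonFam Dcap Ncap K j,
      y K j z G ≤ 0 ∨ ∃ G' : Gen ε, ConsistentTLE sh C K (R K) G' ∧ G'.WF (dictWT sh (R K) C.n₁) ∧
        K < G'.reach (dictWT sh (R K) C.n₁) ∧ relabel (shape ∘ sh) G' = G ∧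
        y K j z G ≤ Δ * (Real.exp (θ * ∑ b ∈ births G', ((((sh b).fat : ℕ) : ℝ) + 1)) *
          (Λ' ^ partnerAges (PEv.step ∘ sh) G' * (Real.exp (-credits (credit C (g K) ∘ sh) G') *
            Real.exp (lifeCost (dictWT sh (R K) C.n₁) (costT sh C K (R K)) G')))))
    (str : ℕ → κ → Finset (BSlot γ PEv))
    (hinj : ∀ K t, |t| ≤ l₀ → K₀ ≤ K → Set.InjOn (str K) (Bad' K t))
    (hstr : ∀ K t, |t| ≤ l₀ → K₀ ≤ K → ∀ c ∈ Bad' K t,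
      str K c ⊆ bliveSlots Cell (canonFam Dcap Ncap) K ∧
        ∃ o ∈ boldSlots Cell (canonFam Dcap Ncap) jstar K, o ∈ str K c)
    (hF : ∀ K t, |t| ≤ l₀ → K₀ ≤ K → ∀ c ∈ Bad' K t, F K c * Rf K c ≤ famWeight (bslotPrice (y K)) (str K c))
    (hF' : ∀ K t, |t| ≤ l₀ → K₀ ≤ K → ∀ c ∈ Bad' K t, F' K c * Rf' K c ≤ famWeight (bslotPrice (y K)) (str K c)) :
    ∃ K₁, K₀ ≤ K₁ ∧ RelWeightBound l₀ T A A' (fun K t => if K₁ ≤ K then badOfClass π T Bad' K t else ∅)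
      (Set.indicator {K | K₁ ≤ K}
        (fun K => Cn * recordsBudget (Δ * birthMass C) C.κ₁ V Λ ηplus jstar K)) := by
  -- the LE exit at HALF the quadratic constant, with its NAMED threshold
  set C' := lowerA C (C.a / 2) with hC'def
  have h' : ThresholdOK C' L r β₀ := thresholdOK_half h
  have ha : 0 < C.a := h.a_pos
  have hA₀ : 0 < C.A₀ := h.A₀_pos
  have hβ : 0 ≤ β₀ := h.β₀_nonneg
  have hp1 : 1 ≤ C.p₀ := by
    have : r * (C.q' + 1) < C.p₀ := h.rq_lt
    omega
  have hir' : ∀ K, K₀ ≤ K → irThresholdTLE C' L r β₀ ≤ Real.log ((g K K) ^ 2)⁻¹ := fun K hK =>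
    (irThresholdTLE_le_irThresholdGTLE C θ L r β₀).trans (hir K hK)
  have hlabTLE : ∀ K, K₀ ≤ K → ∀ j ≤ K, ∀ z ∈ Cell K (K - j), ∀ G ∈ canonFam Dcap Ncap K j,
      y K j z G ≤ 0 ∨ ∃ G' : Gen ε, ConsistentTLE sh C' K (R K) G' ∧ G'.WF (dictWT sh (R K) C'.n₁) ∧
        K < G'.reach (dictWT sh (R K) C'.n₁) ∧ relabel (shape ∘ sh) G' = G ∧
        y K j z G ≤ Δ * (Λ' ^ partnerAges (PEv.step ∘ sh) G' * (Real.exp (-credits (credit C' (g K) ∘ sh) G') *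
          Real.exp (lifeCost (dictWT sh (R K) C'.n₁) (costT sh C' K (R K)) G'))) := by
    intro K hK j hjK z hz G hG
    rcases hlabGTLE K hK j hjK z hz G hG with h0 | ⟨G', hcG, hwG, hKr, hsh, hy⟩
    · exact Or.inl h0
    · refine Or.inr ⟨G', (consistentTLE_lowerA_iff sh C (C.a / 2) K (R K) G').2 hcG, hwG, hKr, hsh, hy.trans ?_⟩
      -- the infrared floor at this cutoff and the half-room
      have hxK1 : 1 ≤ Real.log ((g K K) ^ 2)⁻¹ := (one_le_irThresholdGTLE C θ L r β₀).trans (hir K hK)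
      have hxK2 : 2 * θ * (1 + β₀) ^ 2 / (C.a * C.A₀ ^ 2) ≤ Real.log ((g K K) ^ 2)⁻¹ :=
        (room_le_irThresholdGTLE C θ L r β₀).trans (hir K hK)
      obtain ⟨hPpos, hroom⟩ := half_room_of_threshold ha hA₀ hβ hp1 hxK1 hxK2
      set P := C.A₀ * Real.log ((g K K) ^ 2)⁻¹ ^ C.p₀ / (1 + β₀) with hPdef
      have hPe : ∀ e ∈ G'.events, (sh e).kind = 0 → P ≤ p0Profile C.A₀ C.p₀ (g K (sh e).step) :=
        fun e he _ => by
          have hfl := floor_of_ir (h27 K hK) hβ hA₀.le (by linarith) (step_le_of_consistentTLE hcG e he)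
          simpa [p0Profile, hPdef] using hfl
      have key := exp_mul_fatSumT_mul_exp_neg_credits_le_floor_of_births (sh := sh) (g := g K) hθ hPpos
        (births_subset_filterTLE hcG) hPe
      -- antitonicity: lowering by `θ∕P² ≤ a∕2` leaves at least the credits of `C'`
      have hanti : Real.exp (-credits (credit (lowerA C (θ / P ^ 2)) (g K) ∘ sh) G') ≤
          Real.exp (-credits (credit C' (g K) ∘ sh) G') := by
        rw [Real.exp_le_exp, neg_le_neg_iff, hC'def]
        exact creditsT_lowerA_anti (sh := sh) C (g K) hroom G'
      have hΔ0 : 0 ≤ Δ := zero_le_one.trans hΔ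
      have hcost : lifeCost (dictWT sh (R K) C.n₁) (costT sh C K (R K)) G' =
          lifeCost (dictWT sh (R K) C'.n₁) (costT sh C' K (R K)) G' := by
        rw [hC'def, costT_lowerA, lowerA_n₁]
      rw [hcost]
      set Xl := Real.exp (lifeCost (dictWT sh (R K) C'.n₁) (costT sh C' K (R K)) G')
      set Fb := ∑ b ∈ births G', ((((sh b).fat : ℕ) : ℝ) + 1)
      have hmid := key.trans hanti
      calc Δ * (Real.exp (θ * Fb) * (Λ' ^ partnerAges (PEv.step ∘ sh) G' *
              (Real.exp (-credits (credit C (g K) ∘ sh) G') * Xl)))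
          = Δ * (Λ' ^ partnerAges (PEv.step ∘ sh) G' *
              ((Real.exp (θ * Fb) * Real.exp (-credits (credit C (g K) ∘ sh) G')) * Xl)) := by ring
        _ ≤ Δ * (Λ' ^ partnerAges (PEv.step ∘ sh) G' * (Real.exp (-credits (credit C' (g K) ∘ sh) G') * Xl)) := by
            gcongr
  exact relWeightBound_canon_of_irThresholdLE sh h' hμ₀ Cell hV hΛ hcell Dcap Ncap jstar hj hc hfrac hΔ hA hA' hCn R g
    β' h27 h29 hR hx1 hir' hP hηplus hr hΛ0 h1 hx y hy0 hlabTLE str hinj hstr hF hF'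

/-! ## §3 The LE exit with the zone-crowding binder on the tagged tree (`hlabZSLE`) -/

/-- **THE LE EXIT WITH THE ZONE-CROWDING BINDER ON THE TAGGED TREE (`hlabZSLE`), THRESHOLD NAMED.**  §2 at
`θ := zoneRate Kz p σ ε θ`, `Λ′ := Λ′e^{ε}`, with the binder `hlabZSLE`: the slot price is `≤ 0` or at most
`Δ·Kz^{#merges G′}·(∏_{e ∈ merges G′} Q(wcntS sh G′, σ, (sh e).step)^p)·Λ′^{partnerAges (step∘sh) G′}·e^{−credits}·
e^{+lifeCost}` for SOME `ConsistentTLE`, well formed, BIRTH-SHAPE-GENERIC (`Set.InjOn sh ↑(births G′)`) tagged genealogy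
pending at `K` with the slot's shape tree (= leaf-05's `relWeightBound_lateMergersZS_of_irThreshold` at horizon `0` in
the LE currency).  The two Λ′-rate conditions are stated at `Λ′·e^{ε}`; conclusion = the LE exit's VERBATIM.
[folklore] -/
theorem relWeightBound_lateMergersZS_of_irThresholdLE (sh : ε → PEv) {C : T4PrintedShapeBanking.Consts} {L r : ℕ}
    {β₀ : ℝ} (h : ThresholdOK C L r β₀) (hμ₀ : 0 < C.μ)
    {Kz p σ ε' θ : ℝ} (hKz : 1 ≤ Kz) (hp : 0 ≤ p) (h0 : 0 < σ) (h1σ : σ < 1) (hε : 0 < ε') (hθ : 0 < θ)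
    (Cell : ℕ → ℕ → Finset γ) {V Λ : ℝ} (hV : 0 ≤ V) (hΛ : 0 < Λ)
    (hcell : ∀ K a, ((Cell K a).card : ℝ) ≤ V * Λ ^ a) (Dcap Ncap : ℕ → ℕ)
    (jstar : ℕ → ℕ) (hj : ∀ K, jstar K ≤ K) {c : ℝ} (hc : 0 < c)
    (hfrac : ∀ K : ℕ, c * K ≤ ((K - jstar K : ℕ) : ℝ)) {Δ : ℝ} (hΔ : 1 ≤ Δ)
    (hA : Regeneration l₀ π T A Bad' dead F Rf nlow nup Cn K₀)
    (hA' : Regeneration l₀ π T A' Bad' dead' F' Rf' mlow mup Cn K₀) (hCn : 0 ≤ Cn)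
    (R : ℕ → ℕ → ℕ) (g : ℕ → ℕ → ℝ) (β' : ℕ → ℝ)
    (h27 : ∀ K, K₀ ≤ K → B14.FlowIneq27 (g K) (β' K) β₀ C.p₀ K)
    (h29 : ∀ K, K₀ ≤ K → B14FlowStep.FlowIneq29 (R K) (g K) L (β' K) β₀ K)
    (hR : ∀ K, K₀ ≤ K → ∀ s, s ≤ K → B14.IsRj L r (g K s) (R K s))
    (hx1 : ∀ K, K₀ ≤ K → ∀ s, s ≤ K → 1 ≤ Real.log ((g K s) ^ 2)⁻¹)
    (hir : ∀ K, K₀ ≤ K → irThresholdZTLE C Kz p σ ε' θ L r β₀ ≤ Real.log ((g K K) ^ 2)⁻¹)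
    (hP : ∀ K s, 0 ≤ p0Profile C.A₀ C.p₀ (g K s))
    {ηplus : ℝ} (hηplus : 0 ≤ ηplus) (hr : Λ * Real.exp (ηplus - C.κ₁) < 1)
    {Λ' : ℝ} (hΛ0 : 0 ≤ Λ') (h1 : Λ' * Real.exp ε' * Real.exp (-C.κ₁) * Real.exp ηplus < 1)
    (hx : (Real.exp (-C.E₀) + Real.exp (-C.E₀) * birthMass C *
          (Λ' * Real.exp ε' * Real.exp (-C.κ₁) / (1 - Λ' * Real.exp ε' * Real.exp (-C.κ₁) * Real.exp ηplus))) *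
          Real.exp ηplus ≤
        Real.exp ηplus - 1)
    (y : ℕ → ℕ → γ → Gen PEv → ℝ)
    (hy0 : ∀ K, ∀ j ≤ K, ∀ z ∈ Cell K (K - j), ∀ G ∈ canonFam Dcap Ncap K j, 0 ≤ y K j z G)
    (hlabZSLE : ∀ K, K₀ ≤ K → ∀ j ≤ K, ∀ z ∈ Cell K (K - j), ∀ G ∈ canonFam Dcap Ncap K j,
      y K j z G ≤ 0 ∨ ∃ G' : Gen ε, ConsistentTLE sh C K (R K) G' ∧ G'.WF (dictWT sh (R K) C.n₁) ∧
        Set.InjOn sh ↑(births G') ∧ K < G'.reach (dictWT sh (R K) C.n₁) ∧ relabel (shape ∘ sh) G' = G ∧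
        y K j z G ≤ Δ * (Kz ^ (merges G').card *
          (∏ e ∈ merges G', Crowding.Q (wcntS sh G') σ (sh e).step ^ p) *
          Λ' ^ partnerAges (PEv.step ∘ sh) G' * (Real.exp (-credits (credit C (g K) ∘ sh) G') *
            Real.exp (lifeCost (dictWT sh (R K) C.n₁) (costT sh C K (R K)) G'))))
    (str : ℕ → κ → Finset (BSlot γ PEv))
    (hinj : ∀ K t, |t| ≤ l₀ → K₀ ≤ K → Set.InjOn (str K) (Bad' K t))
    (hstr : ∀ K t, |t| ≤ l₀ → K₀ ≤ K → ∀ c ∈ Bad' K t,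
      str K c ⊆ bliveSlots Cell (canonFam Dcap Ncap) K ∧
        ∃ o ∈ boldSlots Cell (canonFam Dcap Ncap) jstar K, o ∈ str K c)
    (hF : ∀ K t, |t| ≤ l₀ → K₀ ≤ K → ∀ c ∈ Bad' K t, F K c * Rf K c ≤ famWeight (bslotPrice (y K)) (str K c))
    (hF' : ∀ K t, |t| ≤ l₀ → K₀ ≤ K → ∀ c ∈ Bad' K t, F' K c * Rf' K c ≤ famWeight (bslotPrice (y K)) (str K c)) :
    ∃ K₁, K₀ ≤ K₁ ∧ RelWeightBound l₀ T A A' (fun K t => if K₁ ≤ K then badOfClass π T Bad' K t else ∅)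
      (Set.indicator {K | K₁ ≤ K}
        (fun K => Cn * recordsBudget (Δ * birthMass C) C.κ₁ V Λ ηplus jstar K)) := by
  have hθz : 0 ≤ zoneRate Kz p σ ε' θ := zoneRate_nonneg hKz hp h0 h1σ hθ.le
  have hΛ0' : 0 ≤ Λ' * Real.exp ε' := mul_nonneg hΛ0 (Real.exp_pos ε').le
  have hΔ0 : 0 ≤ Δ := zero_le_one.trans hΔ
  have hlabGTLE : ∀ K, K₀ ≤ K → ∀ j ≤ K, ∀ z ∈ Cell K (K - j), ∀ G ∈ canonFam Dcap Ncap K j,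
      y K j z G ≤ 0 ∨ ∃ G' : Gen ε, ConsistentTLE sh C K (R K) G' ∧ G'.WF (dictWT sh (R K) C.n₁) ∧
        K < G'.reach (dictWT sh (R K) C.n₁) ∧ relabel (shape ∘ sh) G' = G ∧
        y K j z G ≤ Δ * (Real.exp (zoneRate Kz p σ ε' θ * ∑ b ∈ births G', ((((sh b).fat : ℕ) : ℝ) + 1)) *
          ((Λ' * Real.exp ε') ^ partnerAges (PEv.step ∘ sh) G' * (Real.exp (-credits (credit C (g K) ∘ sh) G') *
            Real.exp (lifeCost (dictWT sh (R K) C.n₁) (costT sh C K (R K)) G')))) := by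
    intro K hK j hjK z hz G hG
    rcases hlabZSLE K hK j hjK z hz G hG with h0' | ⟨G', hcG, hwG, hinjB, hKr, hsh, hy⟩
    · exact Or.inl h0'
    · refine Or.inr ⟨G', hcG, hwG, hKr, hsh, hy.trans ?_⟩
      -- the zone surcharge of the tagged tree is class-linear (births shape-generic)
      have key := zone_surchargeS_le (sh := sh) (W := dictWT sh (R K) C.n₁) hKz hp h0 h1σ hε hθ hΛ0 hwG
        (stepsOK_of_consistentTLE hcG) (ordered_of_consistentTLE hcG) (kind_eq_zero_of_mem_birthsTLE hcG) hinjB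
      set Xr := Real.exp (-credits (credit C (g K) ∘ sh) G') *
        Real.exp (lifeCost (dictWT sh (R K) C.n₁) (costT sh C K (R K)) G')
      set M := Kz ^ (merges G').card * (∏ e ∈ merges G', Crowding.Q (wcntS sh G') σ (sh e).step ^ p)
      have hX : 0 ≤ Xr := by positivity
      calc Δ * (M * Λ' ^ partnerAges (PEv.step ∘ sh) G' * Xr)
          = Δ * ((M * Λ' ^ partnerAges (PEv.step ∘ sh) G') * Xr) := by ring
        _ ≤ Δ * ((Real.exp (zoneRate Kz p σ ε' θ * ∑ b ∈ births G', ((((sh b).fat : ℕ) : ℝ) + 1)) *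
              (Λ' * Real.exp ε') ^ partnerAges (PEv.step ∘ sh) G') * Xr) := by gcongr
        _ = _ := by ring
  exact relWeightBound_lateMergersG_of_irThresholdLE sh h hμ₀ hθz Cell hV hΛ hcell Dcap Ncap jstar hj hc hfrac hΔ hA
    hA' hCn R g β' h27 h29 hR hx1 hir hP hηplus hr hΛ0' (by simpa [mul_assoc] using h1)
    (by simpa [mul_assoc] using hx) y hy0 hlabGTLE str hinj hstr hF hF'

end EndToEnd

/-! ## §4 Sanity -/

namespace Sanity

/-- the thresholds are `≥ 1`, and the zone one IS the class-linear one at the zone rate (`rfl`) [folklore] -/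
example (C : T4PrintedShapeBanking.Consts) (Kz p σ ε' θ : ℝ) (L r : ℕ) (β₀ : ℝ) :
    1 ≤ irThresholdGTLE C θ L r β₀ ∧ 1 ≤ irThresholdZTLE C Kz p σ ε' θ L r β₀ ∧
      irThresholdZTLE C Kz p σ ε' θ L r β₀ = irThresholdGTLE C (zoneRate Kz p σ ε' θ) L r β₀ :=
  ⟨one_le_irThresholdGTLE C θ L r β₀, one_le_irThresholdGTLE C _ L r β₀, rfl⟩

open HistoryBankingLE.Sanity T4PrintedShapeBanking.XreadC4

/-- the step data of §1 on leaf-02's EARLY renewal (`ConsistentTLE` at `K ≥ 3`, NOT `ConsistentT`): a member shape the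
LE binders admit and the TH binders reject. [folklore] -/
example {K : ℕ} (hK : 3 ≤ K) :
    StepsOK (PEv.step ∘ (Prod.fst : PEv × ℕ → PEv)) early ∧ Ordered (PEv.step ∘ (Prod.fst : PEv × ℕ → PEv)) early ∧
      ¬ ConsistentT (Prod.fst : PEv × ℕ → PEv) C₀ K (fun _ => 2) early :=
  ⟨stepsOK_of_consistentTLE (early_consistentTLE hK), ordered_of_consistentTLE (early_consistentTLE hK),
    early_not_consistentT K⟩

end Sanity

end

end Summit.QuantumFields.BalabanUV.T4Continuum.HistoryZoneSurchargeLE
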